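import Summits.QuantumFields.QCD.Theses.WilsonMobilityGap
import Literature.MathematicalPhysics.QuantumFieldTheory.QCDPhaseQuenched
import HarnessLib.Audit.Tags

/-!
# Crux `PhaseQuenchedFlavourDecay` (stmt-QuantumFields-9151) — proof-side definition of the OPEN CORE
of line `crossing-split-integrability` (routes WilsonMobilityGap / PauliWegnerSea / GaussianLinkFrames)

The registered skeleton `Cruxes/PhaseQuenchedFlavourDecay/Lines/crossing_split_integrability.lean` (leads gen 1,
c1 … c13) is kernel-closed modulo ONE registered stub, `stub_minorMomentsCore`, whose reg-free UNIFORM form is the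
proposition `UniformMinorMoments` below (introduced in the skeleton at r14 by lead c6 and carried there as a local
definition since).  It is the hypothesis, written out in full, of the LANDED closers
`phaseQuenchedFlavourDecay_of_uniformMinorMoments` / `wmgPhaseQuenchedFlavourDecay_of_uniformMinorMoments`
(`Theorems/PauliWegnerSeaPhaseQuenchedFlavourDecayUniformReduction.lean`, p123218), and by the landed diagonal argument
`stub_uniformPencil_of_minorMomentsCore` (p122665) the registered core conversely forces its pencil-uniform constants,
so naming the uniform form loses nothing.

This file gives the core a NAME importable from `Theorems/` (the `Cruxes/` workfile is not importable), so that
(i) the conditional closer can be stated against the named proposition, (ii) the open stub can be registered as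
`UniformMinorMoments_holds : UniformMinorMoments`, and (iii) a future proof — or refutation — of the core has a fixed
target.  NOTHING IS CLAIMED HERE: `UniformMinorMoments` is an UNPROVED statement (a volume-, coupling- and
mass-uniform, `|∏_f det D_f|`-tilted Wegner–Minami-type a-priori estimate for the Wick minors of the Wilson–Dirac
propagator, constants depending on the Fredenhagen–Marcu data `(s, C)` only; no published source proves it; its
deterministic corner is the landed `stub_aprioriDeterministic`, p122460, and its `r = 1, ε = 1` degenerate-doublet
slice is NECESSARY for the crux, p124062 / p152271).  See `Cruxes/PhaseQuenchedFlavourDecay/PROMOTE.md` and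
`NOTES.md` (c1–c13) for the analysis.
-/

noncomputable section

namespace Summit.QuantumFields.QCD.Theorems.PhaseQuenchedFlavourDecayCore

open scoped BigOperators
open MeasureTheory Filter
open Literature.MathematicalPhysics.QuantumFieldTheory Literature.MathematicalPhysics.QuantumLattice
  Literature.Probability.LatticeModels

/-- **UniformMinorMoments** — the reg-free UNIFORM form of the open core of crux `PhaseQuenchedFlavourDecay`
(line `crossing-split-integrability`; UNPROVED, named here as a target).  For every flavour number `N_f` and
all Fredenhagen–Marcu data `(s, C)` with `0 < s < 1` there is ONE exponent `ε > 0` and, for every minor size `r`,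
constants `C_r`, `μ₀ > 0`, `Λ₀` such that at EVERY lattice parameter point (inverse coupling `β : ℝ`, bare mass tuple
`mq`), every lattice rate `0 < μ ≤ μ₀` and every `L` with `Λ₀ ≤ μ L`: if the phase-quenched fractional moments of
the colour–spin entry sum of the Wilson quark propagator decay as `≤ C e^{-μ‖v‖}` on all odd tori of side
`2S+1`, `S ≥ L`, then on the same tori the phase-quenched `(1+ε)`-th moments of ALL `r × r` Wick minors
`det[(D⁻¹)(I a, J b)]_{a,b}` (QuarkVar-indexed, hence jointly over flavours) are integrable and bounded by `C_r`.
Verbatim the hypothesis of the landed `phaseQuenchedFlavourDecay_of_uniformMinorMoments` (p123218).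
STATUS: OPEN — posed in this programme (crux stmt-QuantumFields-9151, line `crossing-split-integrability`,
`Cruxes/PhaseQuenchedFlavourDecay/PROMOTE.md`, Signature B / uniform form, leads c2–c13); no published source states or
proves it.  Nearest published ANALOGUES (rank-one i.i.d. site disorder, untilted): the eigenfunction-correlator /
second-moment step of the fractional-moment method and Minami's estimate — the present statement is their
`|∏_f det D_f|`-tilted, Haar-link-disorder, all-coupling version, for which no proof technology exists (crux NOTES.md
c1–c13; its quenched untilted special case at `β ≥ 1` is the open crux stmt-QuantumFields-8966 `WegnerEstimate`).
[cite: AizenmanEtAl2001, Thm 1.1–1.2 and §4 (finite-volume criteria; second-moment / eigenfunction-correlator bounds from fractional moments, rank-one disorder): the analogue, not this statement]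
[cite: AizenmanWarzel2015, Ch. 7 Thm 7.7 and Ch. 17 (eigenfunction correlators; Minami estimate): the analogue, not this statement]
[cite: Minami1996, Lemma 2 (rank-one two-eigenvalue estimate): the analogue, not this statement]
[status: open] -/
@[conjecture] def UniformMinorMoments : Prop :=
  ∀ (Nf : ℕ) (s C : ℝ), 0 < s → s < 1 → ∃ ε : ℝ, 0 < ε ∧ ∀ r : ℕ, ∃ Cr μ₀ Λ₀ : ℝ, 0 < μ₀ ∧ ∀ (β : ℝ) (mq : Fin Nf → ℝ) (μ : ℝ) (L : ℕ), 0 < μ → μ ≤ μ₀ → Λ₀ ≤ μ * L → (∀ S : ℕ, L ≤ S → ∀ (f : Fin Nf) (v : Literature.Probability.LatticeModels.Site 4), v ∈ box 4 S → (∫ U : GaugeConfig 4 (2 * S + 1) (Matrix.specialUnitaryGroup (Fin 3) ℂ), ‖(diracMatrix U mq).det‖ * (∑ a : Fin 3, ∑ i : Fin 4, ∑ b : Fin 3, ∑ j : Fin 4, ‖(diracMatrix U mq)⁻¹ (quarkEquiv (f, (Torus.proj (2 * S + 1) 0, a, i))) (quarkEquiv (f, (Torus.proj (2 * S + 1) (v),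 b, j)))‖) ^ s ∂(wilsonMeasure (fundamentalRep (Fin 3)) β)) / (∫ U : GaugeConfig 4 (2 * S + 1) (Matrix.specialUnitaryGroup (Fin 3) ℂ), ‖(diracMatrix U mq).det‖ ∂(wilsonMeasure (fundamentalRep (Fin 3)) β)) ≤ C * Real.exp (-(μ * ‖v‖))) → ∀ S : ℕ, L ≤ S → ∀ I J : Fin r → QuarkVar Nf (2 * S + 1), Integrable (fun U : GaugeConfig 4 (2 * S + 1) SU3 => ‖(Matrix.of fun a b : Fin r => (diracMatrix U mq)⁻¹ (quarkEquiv (I a)) (quarkEquiv (J b))).det‖ ^ (1 + ε)) (qcdLatticeMeasure (2 * S + 1) β mq) ∧ qcdPhaseQuenchedExpect β (2 * S + 1) mq (fun U : GaugeConfig 4 (2 * S + 1) SU3 => ‖(Matrix.of fun a b : Fin r => (diracMatrix U mq)⁻¹ (quarkEquiv (I a)) (quarkEquiv (J b))).det‖ ^ (1 + ε)) ≤ Cr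

/-- Unfolding lemma (registered additive stub `uniformMinorMoments_iff` of stmt-QuantumFields-9151): the named conjecture IS,
definitionally, the expanded hypothesis of the landed closer `phaseQuenchedFlavourDecay_of_uniformMinorMoments` (p123218),
so `phaseQuenchedFlavourDecay_of_uniformMinorMoments (uniformMinorMoments_iff.1 h)` closes the crux from `h : UniformMinorMoments`. -/
theorem uniformMinorMoments_iff : UniformMinorMoments ↔ (∀ (Nf : ℕ) (s C : ℝ), 0 < s → s < 1 → ∃ ε : ℝ, 0 < ε ∧ ∀ r : ℕ, ∃ Cr μ₀ Λ₀ : ℝ, 0 < μ₀ ∧ ∀ (β : ℝ) (mq : Fin Nf → ℝ) (μ : ℝ) (L : ℕ), 0 < μ → μ ≤ μ₀ → Λ₀ ≤ μ * L → (∀ S : ℕ, L ≤ S → ∀ (f : Fin Nf) (v : Literature.Probability.LatticeModels.Site 4), v ∈ box 4 S → (∫ U : GaugeConfig 4 (2 * S + 1) (Matrix.specialUnitaryGroup (Fin 3) ℂ), ‖(diracMatrix U mq).det‖ * (∑ a : Fin 3, ∑ i : Fin 4, ∑ b : Fin 3, ∑ j : Fin 4, ‖(diracMatrix U mq)⁻¹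 (quarkEquiv (f, (Torus.proj (2 * S + 1) 0, a, i))) (quarkEquiv (f, (Torus.proj (2 * S + 1) (v), b, j)))‖) ^ s ∂(wilsonMeasure (fundamentalRep (Fin 3)) β)) / (∫ U : GaugeConfig 4 (2 * S + 1) (Matrix.specialUnitaryGroup (Fin 3) ℂ), ‖(diracMatrix U mq).det‖ ∂(wilsonMeasure (fundamentalRep (Fin 3)) β)) ≤ C * Real.exp (-(μ * ‖v‖))) → ∀ S : ℕ, L ≤ S → ∀ I J : Fin r → QuarkVar Nf (2 * S + 1), Integrable (fun U : GaugeConfig 4 (2 * S + 1) SU3 => ‖(Matrix.of fun a b : Fin r => (diracMatrix U mq)⁻¹ (quarkEquiv (I a)) (quarkEquiv (J b))).det‖ ^ (1 + ε)) (qcdLatticeMeasure (2 * S + 1) β mq) ∧ qcdPhaseQuenchedExpect β (2 * S + 1) mq (fun U : GaugeConfig 4 (2 * S + 1) SU3 => ‖(Matrix.of fun a b : Fin r => (diracMatrix U mq)⁻¹ (quarkEquiv (I a)) (quarkEquiv (J b))).det‖ ^ (1 + ε)) ≤ Cr) :=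
  Iff.rfl

end Summit.QuantumFields.QCD.Theorems.PhaseQuenchedFlavourDecayCore

end
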